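import Literature.Analysis.SegalBargmann.HermiteMultiplierStrongContinuity
import Literature.Analysis.SegalBargmann.HermiteSeminormGrowth
import HarnessLib

/-!
# The Hermite matrix of a continuous operator on `𝓢(ℝⁿ)` is tempered (Reed–Simon V.13; Folland 1989, §1.7)

Topic `Analysis/SegalBargmann`; namespace `Literature.Analysis.SegalBargmann`.  By the `N`-representation theorem
(`HermiteExpansionSchwartz`, `HermiteCoefficientDecay`, `HermiteSeminormGrowth`) the Schwartz space `𝓢(ℝ^σ)` is the
space of rapidly decreasing Hermite-coefficient families, seminorm by seminorm.  Hence a CONTINUOUS linear operator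
`A : 𝓢 → 𝓢` has a TEMPERED matrix `a(α, β) := c_α(A h_β)` in the Hermite basis:

* §1 seminorm growth of the operator on the basis: for every Schwartz seminorm index `i`,
  `p_i(A h_β) ≤ C (|β|+1)^k` (`exists_seminorm_apply_herm_le`; Mathlib `Seminorm.bound_of_continuous` + the tree's
  `exists_seminorm_hermiteSchwartz_herm_le`), and the same for finite sums / sups of seminorms;
* §2 **temperedness**: for every `m`, `∃ k C, ∀ β, Σ_α (|α|+1)^m ‖c_α(A h_β)‖ ≤ C (|β|+1)^k`
  (`exists_tsum_degree_pow_mul_norm_hermiteCoeff_apply_herm_le`), in particular entrywise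
  `(|α|+1)^m ‖c_α(A h_β)‖ ≤ C (|β|+1)^k` (`exists_degree_pow_mul_norm_matrix_le`).

Everything is proved from Mathlib and the imported tree files; no cited statement is used as a hypothesis.  Use
(pub-hodgecm node W2-⊗ (⊗S), route (s2)): tempered matrices are the coefficient-space form of continuous operators, in
which the tensor product `A₁ ⊠ A₂` of two operators is again tempered.

## References

* M. Reed, B. Simon, *Methods of Modern Mathematical Physics I*, Theorem V.13 and Appendix to §V.3 (the
  `N`-representation: `𝒮 ≅ s`, continuous operators ↔ tempered matrices).
* [Folland1989] G. B. Folland, *Harmonic Analysis in Phase Space*, Princeton UP (1989), §1.7. [cite: Folland1989, §1.7]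

## Provenance

LEAN-IN-TREE rule (2026-08-18), pub-hodgecm model-construction sub-cell, seat mc-binder-2 gen 2 (node W2-⊗, (⊗S) P2).
-/

set_option autoImplicit false

noncomputable section

open MeasureTheory Complex SchwartzMap Filter Topology
open scoped BigOperators Real NNReal

namespace Literature.Analysis.SegalBargmann

variable {σ : Type*} [Fintype σ] [DecidableEq σ]

local notation "SE" σ => SchwartzMap (EuclideanSpace ℝ σ) ℂ
local notation "𝓅" => schwartzSeminormFamily ℂ (EuclideanSpace ℝ _) ℂ

/-! ## §1  Seminorm growth of a continuous operator on the Hermite basis -/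

section Growth

omit [Fintype σ] [DecidableEq σ] in
/-- Powers of `(|β|+1)` are monotone in the exponent. [folklore] -/
theorem degree_add_one_pow_le_pow {a b : ℕ} (hab : a ≤ b) (β : σ →₀ ℕ) :
    ((β.degree : ℝ) + 1) ^ a ≤ ((β.degree : ℝ) + 1) ^ b :=
  pow_le_pow_right₀ (by have := Nat.cast_nonneg (α := ℝ) β.degree; linarith) hab

/-- **A continuous operator grows polynomially on the Hermite basis, seminorm by seminorm**: for every Schwartz
seminorm `p_{k,l}` there are `K, C` with `p_{k,l}(A h_β) ≤ C (|β|+1)^K` for all `β`. [cite: Folland1989, §1.7] -/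
theorem exists_seminorm_apply_herm_le (A : (SE σ) →L[ℂ] SE σ) (i : ℕ × ℕ) :
    ∃ (K : ℕ) (C : ℝ), 0 ≤ C ∧ ∀ β : σ →₀ ℕ,
      schwartzSeminormFamily ℂ (EuclideanSpace ℝ σ) ℂ i (A (hermiteSchwartz (herm β))) ≤
        C * ((β.degree : ℝ) + 1) ^ K := by
  -- continuity of `p_i ∘ A` in terms of finitely many seminorms
  set q : Seminorm ℂ (SE σ) := (schwartzSeminormFamily ℂ (EuclideanSpace ℝ σ) ℂ i).comp (A : (SE σ) →ₗ[ℂ] SE σ)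
    with hq
  have hqc : Continuous q :=
    ((schwartz_withSeminorms ℂ (EuclideanSpace ℝ σ) ℂ).continuous_seminorm i).comp A.continuous
  obtain ⟨s, C₀, -, hle⟩ := Seminorm.bound_of_continuous (schwartz_withSeminorms ℂ (EuclideanSpace ℝ σ) ℂ) q hqc
  -- growth of each seminorm in `s` on the Hermite functions
  have hgrow : ∀ j : ℕ × ℕ, ∃ C : ℝ, 0 ≤ C ∧ ∀ β : σ →₀ ℕ,
      schwartzSeminormFamily ℂ (EuclideanSpace ℝ σ) ℂ j (hermiteSchwartz (herm β)) ≤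
        C * ((β.degree : ℝ) + 1) ^ (j.1 + j.2 + Fintype.card σ + 1) := fun j => by
    obtain ⟨k, l⟩ := j
    obtain ⟨C, hC0, hC⟩ := exists_seminorm_hermiteSchwartz_herm_le (σ := σ) k l
    exact ⟨C, hC0, fun β => hC β⟩
  choose Cj hCj0 hCj using hgrow
  set K : ℕ := s.sup fun j => j.1 + j.2 + Fintype.card σ + 1 with hK
  refine ⟨K, (C₀ : ℝ) * ∑ j ∈ s, Cj j, mul_nonneg C₀.coe_nonneg (Finset.sum_nonneg fun j _ => hCj0 j), fun β => ?_⟩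
  have h1 : q (hermiteSchwartz (herm β)) ≤ (C₀ • s.sup (schwartzSeminormFamily ℂ (EuclideanSpace ℝ σ) ℂ))
      (hermiteSchwartz (herm β)) := hle _
  rw [hq, Seminorm.comp_apply] at h1
  refine h1.trans ?_
  rw [_root_.smul_apply, NNReal.smul_def, smul_eq_mul, mul_assoc]
  refine mul_le_mul_of_nonneg_left ?_ C₀.coe_nonneg
  refine (finset_sup_schwartzSeminormFamily_apply_le_sum s _).trans ?_
  rw [Finset.sum_mul]
  refine Finset.sum_le_sum fun j hj => (hCj j β).trans ?_
  exact mul_le_mul_of_nonneg_left (degree_add_one_pow_le_pow (Finset.le_sup (f := fun j : ℕ × ℕ =>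
    j.1 + j.2 + Fintype.card σ + 1) hj) β) (hCj0 j)

/-- The same for a finite `sup` of seminorms. [cite: Folland1989, §1.7] -/
theorem exists_sup_seminorm_apply_herm_le (A : (SE σ) →L[ℂ] SE σ) (s : Finset (ℕ × ℕ)) :
    ∃ (K : ℕ) (C : ℝ), 0 ≤ C ∧ ∀ β : σ →₀ ℕ,
      (s.sup (schwartzSeminormFamily ℂ (EuclideanSpace ℝ σ) ℂ)) (A (hermiteSchwartz (herm β))) ≤
        C * ((β.degree : ℝ) + 1) ^ K := by
  have h := fun i : ℕ × ℕ => exists_seminorm_apply_herm_le A i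
  choose Ki Ci hCi0 hCi using h
  refine ⟨s.sup Ki, ∑ i ∈ s, Ci i, Finset.sum_nonneg fun i _ => hCi0 i, fun β => ?_⟩
  refine (finset_sup_schwartzSeminormFamily_apply_le_sum s _).trans ?_
  rw [Finset.sum_mul]
  refine Finset.sum_le_sum fun i hi => (hCi i β).trans ?_
  exact mul_le_mul_of_nonneg_left (degree_add_one_pow_le_pow (Finset.le_sup (f := Ki) hi) β) (hCi0 i)

end Growth

/-! ## §2  Temperedness of the Hermite matrix -/

section Tempered

/-- **The Hermite matrix of a continuous operator is tempered** (summed form): for every `m` there are `k, C` with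
`Σ_α (|α|+1)^m ‖c_α(A h_β)‖ ≤ C (|β|+1)^k` for all `β`. [cite: Folland1989, §1.7] -/
theorem exists_tsum_degree_pow_mul_norm_hermiteCoeff_apply_herm_le (A : (SE σ) →L[ℂ] SE σ) (m : ℕ) :
    ∃ (k : ℕ) (C : ℝ), 0 ≤ C ∧ ∀ β : σ →₀ ℕ,
      ∑' α : σ →₀ ℕ, ((α.degree : ℝ) + 1) ^ m * ‖hermiteCoeff α (A (hermiteSchwartz (herm β)))‖ ≤
        C * ((β.degree : ℝ) + 1) ^ k := by
  obtain ⟨s, C₁, hC₁0, h₁⟩ := exists_tsum_degree_pow_mul_norm_hermiteCoeff_le_sup_seminorm (σ := σ) m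
  obtain ⟨K, C₂, hC₂0, h₂⟩ := exists_sup_seminorm_apply_herm_le A s
  refine ⟨K, C₁ * C₂, mul_nonneg hC₁0 hC₂0, fun β => (h₁ _).trans ?_⟩
  rw [mul_assoc]
  exact mul_le_mul_of_nonneg_left (h₂ β) hC₁0

/-- **Entrywise temperedness**: `(|α|+1)^m ‖c_α(A h_β)‖ ≤ C (|β|+1)^k` for all `α, β`. [cite: Folland1989, §1.7] -/
theorem exists_degree_pow_mul_norm_matrix_le (A : (SE σ) →L[ℂ] SE σ) (m : ℕ) :
    ∃ (k : ℕ) (C : ℝ), 0 ≤ C ∧ ∀ α β : σ →₀ ℕ,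
      ((α.degree : ℝ) + 1) ^ m * ‖hermiteCoeff α (A (hermiteSchwartz (herm β)))‖ ≤ C * ((β.degree : ℝ) + 1) ^ k := by
  obtain ⟨k, C, hC0, h⟩ := exists_tsum_degree_pow_mul_norm_hermiteCoeff_apply_herm_le A m
  refine ⟨k, C, hC0, fun α β => le_trans ?_ (h β)⟩
  refine (summable_degree_pow_mul_norm_hermiteCoeff m (A (hermiteSchwartz (herm β)))).le_tsum α fun γ _ => ?_
  positivity

/-- In particular the matrix entries are polynomially bounded in `β` uniformly in `α`: `‖c_α(A h_β)‖ ≤ C (|β|+1)^k`.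
[cite: Folland1989, §1.7] -/
theorem exists_norm_matrix_le (A : (SE σ) →L[ℂ] SE σ) :
    ∃ (k : ℕ) (C : ℝ), 0 ≤ C ∧ ∀ α β : σ →₀ ℕ,
      ‖hermiteCoeff α (A (hermiteSchwartz (herm β)))‖ ≤ C * ((β.degree : ℝ) + 1) ^ k := by
  obtain ⟨k, C, hC0, h⟩ := exists_degree_pow_mul_norm_matrix_le A 0
  exact ⟨k, C, hC0, fun α β => by simpa only [pow_zero, one_mul] using h α β⟩

end Tempered

end Literature.Analysis.SegalBargmann
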